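import Literature.NumberTheory.LFunctions.ZetaScrewHermitianFormsProofs
import Mathlib.Analysis.Calculus.BumpFunction.Normed
import Mathlib.MeasureTheory.Group.Integral
import HarnessLib

/-!
# Weil positivity on a window ⟹ Kreĭn-kernel positivity — part 1: mollified combs (RH-FREE glue)

LINE 1 — LABEL: RH-FREE glue (the converse window dictionary "Weil rung ⟹ screw depth"), technical half:
the hermitian form on `𝔈₀(a)` under `WeilPositivityOn a`, the real double integral and its bilinearity,
the mollified zero-sum comb, and the bump approximation estimates. The assembled theorem is in the sibling
`Theorems/ZetaStringKernelOfWeilOn.lean`. Nothing in this file asserts any positivity of `ζ`'s Weil form;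
nothing here bears on the truth of RH.
bears_on: LADDER-RH B-D → B-P(P1) (cell rh-dbr, ET6 / TARGET-v7 §K.2 `ArchWallHolds`); companion of the
tree's forward direction `Summit.RiemannHypothesis.RiemannHypothesis.Theorems.screwToWeilOn_proof`
(kernel positivity on `|t| ≤ a` ⟹ `WeilPositivityOn a`).

**Theorem** (sibling file, `isPosSemidefKernelOn_zetaScrewKernel_of_weilPositivityOn`). For every `a : ℝ`, if
`WeilPositivityOn a` (Weil's quadratic functional is non-negative on smooth `g` supported in `[−a, a]`),
then Suzuki's kernel `G(t,u) = Ψ(t) + Ψ(u) − Ψ(t − u)` (`zetaScrewKernel`, Suzuki 2023 (1.4)) is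
positive semidefinite on finite configurations in the OPEN window `(−a, a)` (Suzuki 2023 (1.5),
`IsPosSemidefKernelOn`), i.e. `−Ψ|_{(−2a,2a)} ∈ 𝒢_a`.

**Proof** (mollified combs). By the real/complex bridge `isPosSemidefKernelOn_zetaScrewKernel_iff` it
suffices to treat real weights; augmenting a configuration by the point `0` (where `G(0,·) = G(·,0) = 0`)
makes the weights sum to zero. For a zero-sum system `(sᵢ, wᵢ)` with `|sᵢ| < a` and a normalised smooth
bump `ρ_ε` of radius `ε` (Mathlib's `ContDiffBump.normed`), the comb `φ_ε = Σᵢ wᵢ ρ_ε(· − sᵢ)` is smooth,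
supported in `[−a, a]` for small `ε`, and has mean zero, i.e. `φ_ε ∈ 𝔈₀(a)` (`screwTestC0`); its primitive
`I₀^{(a)}φ_ε ∈ C(a)` (`screwPrimitive_mem_screwTestC`), so `WeilPositivityOn a` and Suzuki 2023 Prop. 3.1 in
the tree's normalisation (`weilQuadratic_eq_zetaScrewForm_deriv`) give
`0 ≤ Re ⟨φ_ε, φ_ε⟩_{G,a} = ∫∫ G(t,u) φ_ε(u) φ_ε(t) du dt = Σᵢⱼ wᵢ wⱼ ∫∫ G(t,u) ρ_ε(t − sᵢ) ρ_ε(u − sⱼ)`.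
By uniform continuity of `G` on the compact square each double integral is within `η` of `G(sᵢ, sⱼ)` once
`ε` is small, so `Σᵢⱼ wᵢ wⱼ G(sᵢ, sⱼ) ≥ −η Σ|wᵢ||wⱼ|` for every `η > 0`.

References: M. Suzuki, J. Lond. Math. Soc. (2) 108 (2023) = arXiv:2206.03682, (1.4), (1.5), (1.11),
(3.6)–(3.7), Prop. 3.1; A. Weil (1952) (positivity criterion); E. Bombieri, Rend. Mat. Acc. Lincei (9) 11
(2000) §3–4.
-/

-- `Summit.RiemannHypothesis.RiemannHypothesis.…` duplicates `RiemannHypothesis` BY DESIGN (D-0017).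
set_option linter.dupNamespace false

noncomputable section

open MeasureTheory Set Filter Metric
open scoped ComplexConjugate BigOperators Topology ContDiff

namespace Summit.RiemannHypothesis.RiemannHypothesis.Theorems.KernelOfWeilOn

open Literature.NumberTheory.LFunctions Literature.Analysis.Complex

variable {a : ℝ}

/-! ## §1 Weil positivity on `[−a,a]` ⟹ `Re ⟨φ,φ⟩_{G,a} ≥ 0` on `𝔈₀(a)` -/

/-- If `ζ` is Weil-positive on `[−a, a]` (`0 < a`), then Suzuki's hermitian form has non-negative real
part on the mean-zero class `𝔈₀(a)`: `0 ≤ Re ⟨φ, φ⟩_{G,a}` — through the primitive `I₀^{(a)}φ ∈ C(a)`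
and Prop. 3.1 (`weilQuadratic_eq_zetaScrewForm_deriv`). (Same reduction as the tree's
`zetaScrewForm_nonneg_of_riemannHypothesis`, with RH replaced by the window hypothesis.)
[cite: Suzuki2023, Prop 3.1 and §3.3 eq. (3.7), p. 7] -/
theorem re_zetaScrewForm_nonneg_of_weilPositivityOn (ha : 0 < a) (hW : WeilPositivityOn a)
    {φ : ℝ → ℂ} (hφ : φ ∈ screwTestC0 a) : 0 ≤ (zetaScrewForm (Ioo (-a) a) φ φ).re := by
  have hψ : screwPrimitive a 0 φ ∈ screwTestC a := screwPrimitive_mem_screwTestC hφ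
  have h : 0 ≤ (weilQuadratic (screwPrimitive a 0 φ)).re := hW _ hψ.1 hψ.2
  rwa [weilQuadratic_eq_zetaScrewForm_deriv ha hψ, deriv_screwPrimitive_of_mem hφ] at h

/-! ## §2 The real double integral and its bilinearity -/

/-- `G = zetaScrewKernel` is jointly continuous. [folklore] -/
theorem continuous_zetaScrewKernel_uncurry :
    Continuous fun p : ℝ × ℝ => zetaScrewKernel p.1 p.2 := by
  unfold zetaScrewKernel
  exact ((continuous_zetaScrew.comp continuous_fst).add
    (continuous_zetaScrew.comp continuous_snd)).sub
      (continuous_zetaScrew.comp (continuous_fst.sub continuous_snd))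

/-- The inner integral `(K g)(t) := ∫_{[−a,a]} G(t,u) g(u) du` of a continuous weight. -/
def innerInt (a : ℝ) (g : ℝ → ℝ) (t : ℝ) : ℝ := ∫ u in Icc (-a) a, zetaScrewKernel t u * g u

/-- The real double integral `D(g, h) := ∫_{[−a,a]} (K g)(t) h(t) dt = ∫∫ G(t,u) g(u) h(t) du dt`. -/
def doubleInt (a : ℝ) (g h : ℝ → ℝ) : ℝ := ∫ t in Icc (-a) a, innerInt a g t * h t

/-- `K g` is continuous for continuous `g` (parametric integral of a jointly continuous integrand over
a compact set). [folklore] -/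
theorem continuous_innerInt {g : ℝ → ℝ} (hg : Continuous g) : Continuous (innerInt a g) := by
  have hc : Continuous (Function.uncurry fun t u : ℝ => zetaScrewKernel t u * g u) :=
    continuous_zetaScrewKernel_uncurry.mul (hg.comp continuous_snd)
  exact continuous_parametric_integral_of_continuous hc isCompact_Icc

/-- `K` is additive in the weight. [folklore] -/
theorem innerInt_add {g₁ g₂ : ℝ → ℝ} (hg₁ : Continuous g₁) (hg₂ : Continuous g₂) (t : ℝ) :
    innerInt a (fun u => g₁ u + g₂ u) t = innerInt a g₁ t + innerInt a g₂ t := by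
  unfold innerInt
  have h1 : IntegrableOn (fun u => zetaScrewKernel t u * g₁ u) (Icc (-a) a) :=
    ((continuous_zetaScrewKernel_uncurry.uncurry_left t).mul hg₁).integrableOn_Icc
  have h2 : IntegrableOn (fun u => zetaScrewKernel t u * g₂ u) (Icc (-a) a) :=
    ((continuous_zetaScrewKernel_uncurry.uncurry_left t).mul hg₂).integrableOn_Icc
  rw [← integral_add h1 h2]
  refine setIntegral_congr_fun measurableSet_Icc fun u _ => ?_
  ring

/-- `K` is homogeneous in the weight. [folklore] -/
theorem innerInt_const_mul (c : ℝ) (g : ℝ → ℝ) (t : ℝ) :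
    innerInt a (fun u => c * g u) t = c * innerInt a g t := by
  unfold innerInt
  rw [← integral_const_mul]
  refine setIntegral_congr_fun measurableSet_Icc fun u _ => ?_
  ring

/-- `K` of a finite linear combination of continuous weights. [folklore] -/
theorem innerInt_sum {ι : Type*} (S : Finset ι) (c : ι → ℝ) {g : ι → ℝ → ℝ}
    (hg : ∀ i, Continuous (g i)) (t : ℝ) :
    innerInt a (fun u => ∑ i ∈ S, c i * g i u) t = ∑ i ∈ S, c i * innerInt a (g i) t := by
  classical
  induction S using Finset.induction_on with
  | empty => simp [innerInt]
  | @insert j S hj ih =>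
    simp only [Finset.sum_insert hj]
    have hc1 : Continuous fun u => c j * g j u := continuous_const.mul (hg j)
    have hc2 : Continuous fun u => ∑ i ∈ S, c i * g i u :=
      continuous_finsetSum S fun i _ => continuous_const.mul (hg i)
    rw [innerInt_add hc1 hc2, innerInt_const_mul, ih]

/-- `D` is additive in the second weight. [folklore] -/
theorem doubleInt_add_right {g h₁ h₂ : ℝ → ℝ} (hg : Continuous g) (hh₁ : Continuous h₁)
    (hh₂ : Continuous h₂) :
    doubleInt a g (fun t => h₁ t + h₂ t) = doubleInt a g h₁ + doubleInt a g h₂ := by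
  unfold doubleInt
  have hK := continuous_innerInt (a := a) hg
  have h1 : IntegrableOn (fun t => innerInt a g t * h₁ t) (Icc (-a) a) :=
    (hK.mul hh₁).integrableOn_Icc
  have h2 : IntegrableOn (fun t => innerInt a g t * h₂ t) (Icc (-a) a) :=
    (hK.mul hh₂).integrableOn_Icc
  rw [← integral_add h1 h2]
  refine setIntegral_congr_fun measurableSet_Icc fun t _ => ?_
  ring

/-- `D` is homogeneous in the second weight. [folklore] -/
theorem doubleInt_const_mul_right (c : ℝ) (g h : ℝ → ℝ) :
    doubleInt a g (fun t => c * h t) = c * doubleInt a g h := by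
  unfold doubleInt
  rw [← integral_const_mul]
  refine setIntegral_congr_fun measurableSet_Icc fun t _ => ?_
  ring

/-- `D` of a finite linear combination in the second weight. [folklore] -/
theorem doubleInt_sum_right {ι : Type*} (S : Finset ι) (c : ι → ℝ) {g : ℝ → ℝ} {h : ι → ℝ → ℝ}
    (hg : Continuous g) (hh : ∀ i, Continuous (h i)) :
    doubleInt a g (fun t => ∑ i ∈ S, c i * h i t) = ∑ i ∈ S, c i * doubleInt a g (h i) := by
  classical
  induction S using Finset.induction_on with
  | empty => simp [doubleInt]
  | @insert j S hj ih =>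
    simp only [Finset.sum_insert hj]
    have hc1 : Continuous fun t => c j * h j t := continuous_const.mul (hh j)
    have hc2 : Continuous fun t => ∑ i ∈ S, c i * h i t :=
      continuous_finsetSum S fun i _ => continuous_const.mul (hh i)
    rw [doubleInt_add_right hg hc1 hc2, doubleInt_const_mul_right, ih]

/-- `D` of a finite linear combination in the first weight. [folklore] -/
theorem doubleInt_sum_left {ι : Type*} (S : Finset ι) (c : ι → ℝ) {g : ι → ℝ → ℝ} {h : ℝ → ℝ}
    (hg : ∀ i, Continuous (g i)) (hh : Continuous h) :
    doubleInt a (fun u => ∑ i ∈ S, c i * g i u) h = ∑ i ∈ S, c i * doubleInt a (g i) h := by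
  unfold doubleInt
  simp_rw [innerInt_sum S c hg, Finset.sum_mul]
  have hi : ∀ i ∈ S, IntegrableOn (fun t => c i * innerInt a (g i) t * h t) (Icc (-a) a) :=
    fun i _ => ((continuous_const.mul (continuous_innerInt (hg i))).mul hh).integrableOn_Icc
  rw [integral_finsetSum S hi]
  refine Finset.sum_congr rfl fun i _ => ?_
  rw [← integral_const_mul]
  refine setIntegral_congr_fun measurableSet_Icc fun t _ => ?_
  ring

/-! ## §3 The form on real weights, and the mollified zero-sum comb -/

/-- For a continuous REAL weight `f`, `Re ⟨f, f⟩_{G,a} = D(f, f) = ∫∫ G(t,u) f(u) f(t) du dt`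
(the window `(−a,a)` may be replaced by the compact `[−a,a]`, null endpoints). [folklore] -/
theorem re_zetaScrewForm_ofReal (f : ℝ → ℝ) :
    (zetaScrewForm (Ioo (-a) a) (fun u => (f u : ℂ)) (fun u => (f u : ℂ))).re = doubleInt a f f := by
  unfold zetaScrewForm doubleInt innerInt
  rw [setIntegral_congr_set Ioo_ae_eq_Icc]
  have hin : ∀ t, ∫ u in Ioo (-a) a, (zetaScrewKernel t u : ℂ) * (f u : ℂ) * conj ((f t : ℂ)) =
      (((∫ u in Icc (-a) a, zetaScrewKernel t u * f u) * f t : ℝ) : ℂ) := by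
    intro t
    rw [setIntegral_congr_set Ioo_ae_eq_Icc]
    have h1 : ∀ u, (zetaScrewKernel t u : ℂ) * (f u : ℂ) * conj ((f t : ℂ)) =
        ((zetaScrewKernel t u * f u * f t : ℝ) : ℂ) := by
      intro u
      rw [Complex.conj_ofReal]
      push_cast
      ring
    simp_rw [h1]
    rw [integral_complex_ofReal, ← integral_mul_const]
  simp_rw [hin]
  rw [integral_complex_ofReal, Complex.ofReal_re]

/-- The mollified comb `u ↦ Σᵢ wᵢ ρ(u − sᵢ)` on a normalised bump `ρ = β.normed` (centre `0`,
outer radius `β.rOut`). -/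
def comb {N : ℕ} (s w : Fin N → ℝ) (β : ContDiffBump (0 : ℝ)) (u : ℝ) : ℝ :=
  ∑ i, w i * β.normed volume (u - s i)

/-- The translated bump `u ↦ ρ(u − c)` is continuous. [folklore] -/
theorem continuous_normed_sub (β : ContDiffBump (0 : ℝ)) (c : ℝ) :
    Continuous fun u => β.normed volume (u - c) :=
  β.continuous_normed.comp (continuous_id.sub continuous_const)

/-- The comb is continuous. [folklore] -/
theorem continuous_comb {N : ℕ} (s w : Fin N → ℝ) (β : ContDiffBump (0 : ℝ)) :
    Continuous (comb s w β) :=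
  continuous_finsetSum _ fun i _ => continuous_const.mul (continuous_normed_sub β (s i))

/-- Off the ball of radius `β.rOut` about `c` the translated bump vanishes. [folklore] -/
theorem normed_sub_eq_zero (β : ContDiffBump (0 : ℝ)) {c u : ℝ} (hu : β.rOut ≤ |u - c|) :
    β.normed volume (u - c) = 0 := by
  have h : u - c ∉ Function.support (β.normed volume) := by
    rw [β.support_normed_eq, Metric.mem_ball, dist_zero_right, Real.norm_eq_abs, not_lt]
    exact hu
  simpa [Function.mem_support] using h

/-- The translated bump integrates to `1` over any window `[−a, a]` containing its support
(`|c| + β.rOut ≤ a`). [folklore] -/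
theorem setIntegral_normed_sub (β : ContDiffBump (0 : ℝ)) {c : ℝ} (hc : |c| + β.rOut ≤ a) :
    ∫ u in Icc (-a) a, β.normed volume (u - c) = 1 := by
  rw [setIntegral_eq_integral_of_forall_compl_eq_zero, integral_sub_right_eq_self, β.integral_normed]
  intro u hu
  refine normed_sub_eq_zero β (not_lt.1 fun hlt => hu ?_)
  have h1 : |u| ≤ a := by
    have h2 := abs_sub_abs_le_abs_sub u c
    linarith
  exact ⟨(abs_le.1 h1).1, (abs_le.1 h1).2⟩

/-- **The comb is a mean-zero test function**: for `Σ wᵢ = 0` and `|sᵢ| + β.rOut ≤ a`, the complexified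
comb `u ↦ Σᵢ wᵢ ρ(u − sᵢ)` belongs to `𝔈₀(a)` (smooth, supported in `[−a,a]`, `∫ = 0`).
[cite: Suzuki2023, §1 eq. (1.11), p. 3] -/
theorem comb_mem_screwTestC0 {N : ℕ} (s w : Fin N → ℝ) (β : ContDiffBump (0 : ℝ))
    (hs : ∀ i, |s i| + β.rOut ≤ a) (hw : ∑ i, w i = 0) :
    (fun u => ((comb s w β u : ℝ) : ℂ)) ∈ screwTestC0 a := by
  -- support inside the window
  have hsupp : Function.support (fun u => ((comb s w β u : ℝ) : ℂ)) ⊆ Icc (-a) a := by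
    intro u hu
    rw [Function.mem_support, ne_eq, Complex.ofReal_eq_zero] at hu
    obtain ⟨i, -, hi⟩ := Finset.exists_ne_zero_of_sum_ne_zero hu
    have hρ : β.normed volume (u - s i) ≠ 0 := fun h => hi (by rw [h, mul_zero])
    have hlt : |u - s i| < β.rOut := not_le.1 fun h => hρ (normed_sub_eq_zero β h)
    have h1 : |u| ≤ a := by
      have h2 := abs_sub_abs_le_abs_sub u (s i)
      have h3 := hs i
      linarith
    exact ⟨(abs_le.1 h1).1, (abs_le.1 h1).2⟩
  have htsupp : tsupport (fun u => ((comb s w β u : ℝ) : ℂ)) ⊆ Icc (-a) a :=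
    closure_minimal hsupp isClosed_Icc
  refine ⟨⟨?_, ?_⟩, htsupp, ?_⟩
  · -- smooth
    have hc : ContDiff ℝ ∞ (comb s w β) := by
      unfold comb
      exact ContDiff.sum fun i _ => contDiff_const.mul
        (β.contDiff_normed.comp (contDiff_id.sub contDiff_const))
    exact Complex.ofRealCLM.contDiff.comp hc
  · exact HasCompactSupport.of_support_subset_isCompact isCompact_Icc hsupp
  · -- mean zero
    show ∫ u, ((comb s w β u : ℝ) : ℂ) = 0
    rw [integral_complex_ofReal, Complex.ofReal_eq_zero]
    unfold comb
    rw [integral_finsetSum _ fun i _ => (β.integrable_normed.comp_sub_right (s i)).const_mul (w i)]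
    simp_rw [integral_const_mul, integral_sub_right_eq_self _ , β.integral_normed, mul_one]
    exact hw

/-! ## §4 The bump double integrals approximate point values of `G` -/

/-- Inner estimate: if `|G(t,u) − G(s,s')| ≤ η` for all `u` within `β.rOut` of `s'` (and the bump at `s'`
fits in the window), then `|(K ρ(· − s'))(t) − G(s,s')| ≤ η`. [folklore] -/
theorem abs_innerInt_sub_le (β : ContDiffBump (0 : ℝ)) {s s' t η : ℝ} (hs' : |s'| + β.rOut ≤ a)
    (hG : ∀ u, |u - s'| < β.rOut → |zetaScrewKernel t u - zetaScrewKernel s s'| ≤ η) :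
    |innerInt a (fun u => β.normed volume (u - s')) t - zetaScrewKernel s s'| ≤ η := by
  have hρc := continuous_normed_sub β s'
  have hone := setIntegral_normed_sub (a := a) β hs'
  have hI1 : IntegrableOn (fun u => zetaScrewKernel t u * β.normed volume (u - s')) (Icc (-a) a) :=
    ((continuous_zetaScrewKernel_uncurry.uncurry_left t).mul hρc).integrableOn_Icc
  have hI2 : IntegrableOn (fun u => zetaScrewKernel s s' * β.normed volume (u - s')) (Icc (-a) a) :=
    (continuous_const.mul hρc).integrableOn_Icc
  have hc : zetaScrewKernel s s' = ∫ u in Icc (-a) a, zetaScrewKernel s s' * β.normed volume (u - s') := by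
    rw [integral_const_mul, hone, mul_one]
  unfold innerInt
  rw [hc, ← integral_sub hI1 hI2]
  have hbound : ∀ u, ‖zetaScrewKernel t u * β.normed volume (u - s')
      - zetaScrewKernel s s' * β.normed volume (u - s')‖ ≤ η * β.normed volume (u - s') := by
    intro u
    rw [← sub_mul, norm_mul, Real.norm_eq_abs, Real.norm_eq_abs, abs_of_nonneg (β.nonneg_normed _)]
    by_cases hu : |u - s'| < β.rOut
    · exact mul_le_mul_of_nonneg_right (hG u hu) (β.nonneg_normed _)
    · rw [normed_sub_eq_zero β (not_lt.1 hu), mul_zero, mul_zero]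
  calc |∫ u in Icc (-a) a, (zetaScrewKernel t u * β.normed volume (u - s')
          - zetaScrewKernel s s' * β.normed volume (u - s'))|
      ≤ ∫ u in Icc (-a) a, η * β.normed volume (u - s') := by
        rw [← Real.norm_eq_abs]
        exact norm_integral_le_of_norm_le ((continuous_const.mul hρc).integrableOn_Icc)
          (Eventually.of_forall hbound)
    _ = η := by rw [integral_const_mul, hone, mul_one]

/-- Outer estimate: if `|G(t,u) − G(s,s')| ≤ η` whenever `|t − s| < β.rOut` and `|u − s'| < β.rOut`
(both bumps inside the window), then `|D(ρ(· − s'), ρ(· − s)) − G(s,s')| ≤ η`. [folklore] -/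
theorem abs_doubleInt_sub_le (β : ContDiffBump (0 : ℝ)) {s s' η : ℝ} (hs : |s| + β.rOut ≤ a)
    (hs' : |s'| + β.rOut ≤ a)
    (hG : ∀ t u, |t - s| < β.rOut → |u - s'| < β.rOut →
      |zetaScrewKernel t u - zetaScrewKernel s s'| ≤ η) :
    |doubleInt a (fun u => β.normed volume (u - s')) (fun t => β.normed volume (t - s))
      - zetaScrewKernel s s'| ≤ η := by
  have hρc := continuous_normed_sub β s
  have hone := setIntegral_normed_sub (a := a) β hs
  have hK := continuous_innerInt (a := a) (continuous_normed_sub β s')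
  have hI1 : IntegrableOn (fun t => innerInt a (fun u => β.normed volume (u - s')) t
      * β.normed volume (t - s)) (Icc (-a) a) := (hK.mul hρc).integrableOn_Icc
  have hI2 : IntegrableOn (fun t => zetaScrewKernel s s' * β.normed volume (t - s)) (Icc (-a) a) :=
    (continuous_const.mul hρc).integrableOn_Icc
  have hc : zetaScrewKernel s s' = ∫ t in Icc (-a) a, zetaScrewKernel s s' * β.normed volume (t - s) := by
    rw [integral_const_mul, hone, mul_one]
  unfold doubleInt
  rw [hc, ← integral_sub hI1 hI2]
  have hbound : ∀ t, ‖innerInt a (fun u => β.normed volume (u - s')) t * β.normed volume (t - s)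
      - zetaScrewKernel s s' * β.normed volume (t - s)‖ ≤ η * β.normed volume (t - s) := by
    intro t
    rw [← sub_mul, norm_mul, Real.norm_eq_abs, Real.norm_eq_abs, abs_of_nonneg (β.nonneg_normed _)]
    by_cases ht : |t - s| < β.rOut
    · exact mul_le_mul_of_nonneg_right (abs_innerInt_sub_le β hs' (fun u hu => hG t u ht hu))
        (β.nonneg_normed _)
    · rw [normed_sub_eq_zero β (not_lt.1 ht), mul_zero, mul_zero]
  calc |∫ t in Icc (-a) a, (innerInt a (fun u => β.normed volume (u - s')) t * β.normed volume (t - s)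
          - zetaScrewKernel s s' * β.normed volume (t - s))|
      ≤ ∫ t in Icc (-a) a, η * β.normed volume (t - s) := by
        rw [← Real.norm_eq_abs]
        exact norm_integral_le_of_norm_le ((continuous_const.mul hρc).integrableOn_Icc)
          (Eventually.of_forall hbound)
    _ = η := by rw [integral_const_mul, hone, mul_one]

end Summit.RiemannHypothesis.RiemannHypothesis.Theorems.KernelOfWeilOn

end
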